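import Mathlib
import Literature.Computability.Complexity.RandomKSatEnsembleOGP

/-!
# Route OverlapGapAlgebra, crux `SearchHardWindow` (stmt-PneNP-2460), line `Sketch`:
# a fixed assignment satisfies an `E`-resampled instance with probability `≤ (1 − (E/2)^k)^m`

In the with-replacement literal model a `k`-SAT instance with `m` clauses over `n` variables is a
literal array `y' : Fin m × Fin k → Fin n × Bool` (clause `i` occupies the slots `(i, j)`,
`j < k`; the literal `(v, b)` is TRUE under an assignment `x : Fin n → Bool` iff `x v = b`).
One step of the `E`-resampling kernel `resampleKernel E w ·` of
`Literature/Computability/Complexity/RandomKSatEnsembleOGP.lean` from a FIXED instance `w` redraws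
every slot independently: kept with probability `1 − E`, redrawn uniformly among the `2n` literals
with probability `E`; its weights are `∏_s κ(w s, y' s)` with
`κ(a, c) = (1 − E)·[a = c] + E/(2n)`.

`stub_satProbBound` (the first-moment input of the chaos lemma, Huang–Sellke 2025 Lemma 3.23, in
cycle 2 of line `Sketch`): for a FIXED assignment `x` and `0 ≤ E ≤ 1`, the kernel-mass of the
instances satisfied by `x` is `≤ (1 − (E/2)^k)^m`.

Proof (an exact computation followed by a bound, `spb_abstract`): the satisfaction indicator
factors over the clauses, `[x ⊨ y'] = ∏_i (1 − ∏_j f(y' (i, j)))` with `f(c) = [c false under x]`,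
and so does the kernel; hence the sum over `y'` is the product over the clauses `i` of the block
sums `Σ_{c : Fin k → Γ} (∏_j κ(w (i,j), c j)) (1 − ∏_j f (c j)) = 1 − ∏_j T(w (i, j))`
(`Fintype.prod_sum`, stochasticity `Σ_c κ(a, c) = 1`), where
`T(a) = Σ_c κ(a, c) f(c) = (1 − E) f(a) + (E/(2n))·n = (1 − E) f(a) + E/2 ∈ [E/2, 1]`
(exactly `n` of the `2n` literals are false under `x`). Each clause factor therefore lies in
`[0, 1 − (E/2)^k]`, and the product of the `m` factors is `≤ (1 − (E/2)^k)^m`.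
-/

set_option linter.dupNamespace false -- `Summit.PneNP.PneNP.…`: summit = sub-problem

namespace Summit.PneNP.PneNP.Theorems

open Finset
open Literature.Computability.Complexity
open scoped Classical

/-- Block factorisation of a sum over functions on a product type: if the summand is a product
over `i : α` of functions of the `i`-th row `fun j => y (i, j)`, the sum over `y : α × β → Γ` is the
product over `i` of the row sums (`Equiv.curry` followed by `Fintype.prod_sum`). -/
theorem spb_sum_prod_curry {α β Γ : Type*} [Fintype α] [DecidableEq α] [Fintype β] [DecidableEq β]
    [Fintype Γ]
    (g : α → (β → Γ) → ℝ) :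
    ∑ y : α × β → Γ, ∏ i, g i (fun j => y (i, j)) = ∏ i, ∑ c : β → Γ, g i c := by
  rw [Fintype.prod_sum]
  exact Fintype.sum_equiv (Equiv.curry α β Γ) _ _ (fun y => rfl)

/-- **Abstract first-moment bound.** For a row-stochastic kernel `κ` on a finite type `Γ` and a
weight `f` whose one-step averages `T(b) = Σ_c κ(b, c) f(c)` all lie in `[t, 1]` with `0 ≤ t`, the
`κ^{⊗ slots}`-average over `y' : Fin m × Fin k → Γ` of `∏_i (1 − ∏_j f (y' (i, j)))` is
`≤ (1 − t^k)^m`: it equals `∏_i (1 − ∏_j T(w (i, j)))` exactly. -/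
theorem spb_abstract {Γ : Type*} [Fintype Γ] (m k : ℕ) (κ : Γ → Γ → ℝ) (f : Γ → ℝ) (t : ℝ)
    (ht0 : 0 ≤ t) (hsto : ∀ b, ∑ c, κ b c = 1) (hlow : ∀ b, t ≤ ∑ c, κ b c * f c)
    (hup : ∀ b, ∑ c, κ b c * f c ≤ 1) (w : Fin m × Fin k → Γ) :
    ∑ y' : Fin m × Fin k → Γ, (∏ s, κ (w s) (y' s)) *
        ∏ i : Fin m, (1 - ∏ j : Fin k, f (y' (i, j)))
      ≤ (1 - t ^ k) ^ m := by
  have hsummand : ∀ y' : Fin m × Fin k → Γ,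
      (∏ s, κ (w s) (y' s)) * ∏ i : Fin m, (1 - ∏ j : Fin k, f (y' (i, j)))
        = ∏ i : Fin m, ((∏ j : Fin k, κ (w (i, j)) (y' (i, j))) *
            (1 - ∏ j : Fin k, f (y' (i, j)))) := by
    intro y'
    rw [Fintype.prod_prod_type, ← Finset.prod_mul_distrib]
  have hclause : ∀ i : Fin m, ∑ c : Fin k → Γ,
      (∏ j : Fin k, κ (w (i, j)) (c j)) * (1 - ∏ j : Fin k, f (c j))
        = 1 - ∏ j : Fin k, ∑ c, κ (w (i, j)) c * f c := by
    intro i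
    simp_rw [mul_sub, mul_one, Finset.sum_sub_distrib, ← Finset.prod_mul_distrib]
    rw [← Fintype.prod_sum (fun j c => κ (w (i, j)) c),
      ← Fintype.prod_sum (fun j c => κ (w (i, j)) c * f c)]
    simp only [hsto, Finset.prod_const_one]
  calc ∑ y' : Fin m × Fin k → Γ, (∏ s, κ (w s) (y' s)) *
          ∏ i : Fin m, (1 - ∏ j : Fin k, f (y' (i, j)))
      = ∑ y' : Fin m × Fin k → Γ, ∏ i : Fin m, ((∏ j : Fin k, κ (w (i, j)) (y' (i, j))) *
            (1 - ∏ j : Fin k, f (y' (i, j)))) :=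
        Finset.sum_congr rfl (fun y' _ => hsummand y')
    _ = ∏ i : Fin m, ∑ c : Fin k → Γ,
          (∏ j : Fin k, κ (w (i, j)) (c j)) * (1 - ∏ j : Fin k, f (c j)) :=
        spb_sum_prod_curry
          (fun i c => (∏ j : Fin k, κ (w (i, j)) (c j)) * (1 - ∏ j : Fin k, f (c j)))
    _ = ∏ i : Fin m, (1 - ∏ j : Fin k, ∑ c, κ (w (i, j)) c * f c) :=
        Finset.prod_congr rfl (fun i _ => hclause i)
    _ ≤ ∏ _i : Fin m, (1 - t ^ k) := by
        refine Finset.prod_le_prod (fun i _ => ?_) (fun i _ => ?_)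
        · exact sub_nonneg.mpr
            (Finset.prod_le_one (fun j _ => le_trans ht0 (hlow _)) (fun j _ => hup _))
        · have hk : t ^ k ≤ ∏ j : Fin k, ∑ c, κ (w (i, j)) c * f c :=
            calc t ^ k = ∏ _j : Fin k, t := by simp
              _ ≤ ∏ j : Fin k, ∑ c, κ (w (i, j)) c * f c :=
                Finset.prod_le_prod (fun j _ => ht0) (fun j _ => hlow _)
          linarith
    _ = (1 - t ^ k) ^ m := by simp

/-- There are `2n` literals over `n` variables. -/
theorem spb_card_lit (n : ℕ) : (Fintype.card (Fin n × Bool) : ℝ) = 2 * n := by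
  rw [Fintype.card_prod, Fintype.card_fin, Fintype.card_bool]
  push_cast
  ring

/-- Exactly `n` of the `2n` literals are false under a fixed assignment `x`:
`Σ_{(v, b)} [x v ≠ b] = n` (for each variable `v` exactly one polarity is false). -/
theorem spb_false_count (n : ℕ) (x : Fin n → Bool) :
    ∑ c : Fin n × Bool, (if x c.1 = c.2 then (0 : ℝ) else 1) = n := by
  rw [Fintype.sum_prod_type]
  simp only [Fintype.sum_bool]
  have h : ∀ v : Fin n,
      ((if x v = true then (0 : ℝ) else 1) + (if x v = false then (0 : ℝ) else 1)) = 1 := by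
    intro v
    cases x v <;> simp
  simp only [h, Finset.sum_const, Finset.card_univ, Fintype.card_fin, nsmul_eq_mul, mul_one]

/-- One coordinate of the literal-resampling kernel is a probability vector:
`Σ_c ((1 − E)·[b = c] + E/(2n)) = 1` (needs `n ≥ 1`). -/
theorem spb_coord_sum_one (n : ℕ) (hn : 1 ≤ n) (E : ℝ) (b : Fin n × Bool) :
    ∑ c : Fin n × Bool,
        ((1 - E) * (if b = c then (1 : ℝ) else 0) + E / Fintype.card (Fin n × Bool)) = 1 := by
  have hn' : (n : ℝ) ≠ 0 := by exact_mod_cast (by omega : n ≠ 0)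
  rw [Finset.sum_add_distrib, ← Finset.mul_sum, Fintype.sum_ite_eq, Finset.sum_const,
    Finset.card_univ, nsmul_eq_mul, spb_card_lit]
  field_simp
  ring

/-- The one-step false-mass of a resampled slot: with `f(c) = [c false under x]`,
`Σ_c ((1 − E)·[a = c] + E/(2n))·f(c) = (1 − E)·f(a) + E/2`. -/
theorem spb_coord_false_sum (n : ℕ) (hn : 1 ≤ n) (E : ℝ) (x : Fin n → Bool)
    (a : Fin n × Bool) :
    ∑ c : Fin n × Bool,
        ((1 - E) * (if a = c then (1 : ℝ) else 0) + E / Fintype.card (Fin n × Bool)) *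
          (if x c.1 = c.2 then (0 : ℝ) else 1)
      = (1 - E) * (if x a.1 = a.2 then (0 : ℝ) else 1) + E / 2 := by
  have hn' : (n : ℝ) ≠ 0 := by exact_mod_cast (by omega : n ≠ 0)
  have h1 : ∀ c : Fin n × Bool,
      ((1 - E) * (if a = c then (1 : ℝ) else 0) + E / Fintype.card (Fin n × Bool)) *
          (if x c.1 = c.2 then (0 : ℝ) else 1)
        = (1 - E) * (if a = c then (if x c.1 = c.2 then (0 : ℝ) else 1) else 0)
          + E / (2 * n) * (if x c.1 = c.2 then (0 : ℝ) else 1) := by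
    intro c
    rw [spb_card_lit]
    by_cases hac : a = c
    · rw [if_pos hac, if_pos hac]
      ring
    · rw [if_neg hac, if_neg hac]
      ring
  have h2 : E / (2 * (n : ℝ)) * n = E / 2 := by
    field_simp
  rw [Finset.sum_congr rfl (fun c _ => h1 c), Finset.sum_add_distrib, ← Finset.mul_sum,
    ← Finset.mul_sum, Fintype.sum_ite_eq, spb_false_count, h2]

/-- **A fixed assignment satisfies a resampled instance with probability `≤ (1 − (E/2)^k)^m`**
(first-moment input of the chaos lemma, Huang–Sellke 2025 Lemma 3.23): resampling each literal of
a fixed instance `w` independently with probability `E` (uniformly among the `2n` literals, exactly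
half of which are false under `x`), every clause stays violated by `x` with probability
`≥ (E/2)^k`, independently over the `m` clauses. -/
theorem stub_satProbBound (n m k : ℕ) (hn : 1 ≤ n) (E : ℝ) (hE0 : 0 ≤ E) (hE1 : E ≤ 1)
    (x : Fin n → Bool) (w : Fin m × Fin k → Fin n × Bool) :
    ∑ y' : Fin m × Fin k → Fin n × Bool, resampleKernel E w y' *
        (if (∀ i : Fin m, ∃ j : Fin k, x (y' (i, j)).1 = (y' (i, j)).2) then (1 : ℝ) else 0)
      ≤ (1 - (E / 2) ^ k) ^ m := by
  -- the satisfaction indicator factors over the clauses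
  have hind : ∀ y' : Fin m × Fin k → Fin n × Bool,
      (if (∀ i : Fin m, ∃ j : Fin k, x (y' (i, j)).1 = (y' (i, j)).2) then (1 : ℝ) else 0)
        = ∏ i : Fin m, (1 - ∏ j : Fin k, (if x (y' (i, j)).1 = (y' (i, j)).2 then (0 : ℝ) else 1)) := by
    intro y'
    by_cases h : ∀ i : Fin m, ∃ j : Fin k, x (y' (i, j)).1 = (y' (i, j)).2
    · rw [if_pos h]
      symm
      refine Finset.prod_eq_one (fun i _ => ?_)
      obtain ⟨j, hj⟩ := h i
      have h0 : (∏ j : Fin k, (if x (y' (i, j)).1 = (y' (i, j)).2 then (0 : ℝ) else 1)) = 0 :=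
        Finset.prod_eq_zero (Finset.mem_univ j) (if_pos hj)
      rw [h0, sub_zero]
    · rw [if_neg h]
      symm
      push Not at h
      obtain ⟨i, hi⟩ := h
      refine Finset.prod_eq_zero (Finset.mem_univ i) ?_
      have h1 : (∏ j : Fin k, (if x (y' (i, j)).1 = (y' (i, j)).2 then (0 : ℝ) else 1)) = 1 :=
        Finset.prod_eq_one (fun j _ => if_neg (hi j))
      rw [h1, sub_self]
  -- one-step false-masses lie in `[E/2, 1]`
  have hT := spb_coord_false_sum n hn E x
  have hf0 : ∀ c : Fin n × Bool, (0 : ℝ) ≤ (if x c.1 = c.2 then (0 : ℝ) else 1) := fun c => by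
    split_ifs <;> norm_num
  have hf1 : ∀ c : Fin n × Bool, (if x c.1 = c.2 then (0 : ℝ) else 1) ≤ 1 := fun c => by
    split_ifs <;> norm_num
  have hlow : ∀ b : Fin n × Bool, E / 2 ≤ ∑ c : Fin n × Bool,
      ((1 - E) * (if b = c then (1 : ℝ) else 0) + E / Fintype.card (Fin n × Bool)) *
        (if x c.1 = c.2 then (0 : ℝ) else 1) := by
    intro b
    rw [hT b]
    have : 0 ≤ (1 - E) * (if x b.1 = b.2 then (0 : ℝ) else 1) :=
      mul_nonneg (sub_nonneg.mpr hE1) (hf0 b)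
    linarith
  have hup : ∀ b : Fin n × Bool, ∑ c : Fin n × Bool,
      ((1 - E) * (if b = c then (1 : ℝ) else 0) + E / Fintype.card (Fin n × Bool)) *
        (if x c.1 = c.2 then (0 : ℝ) else 1) ≤ 1 := by
    intro b
    rw [hT b]
    have : (1 - E) * (if x b.1 = b.2 then (0 : ℝ) else 1) ≤ 1 - E :=
      mul_le_of_le_one_right (sub_nonneg.mpr hE1) (hf1 b)
    linarith
  have key := spb_abstract m k
    (fun b c : Fin n × Bool =>
      (1 - E) * (if b = c then (1 : ℝ) else 0) + E / Fintype.card (Fin n × Bool))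
    (fun c : Fin n × Bool => if x c.1 = c.2 then (0 : ℝ) else 1) (E / 2) (by linarith)
    (spb_coord_sum_one n hn E) hlow hup w
  calc ∑ y' : Fin m × Fin k → Fin n × Bool, resampleKernel E w y' *
          (if (∀ i : Fin m, ∃ j : Fin k, x (y' (i, j)).1 = (y' (i, j)).2) then (1 : ℝ) else 0)
      = ∑ y' : Fin m × Fin k → Fin n × Bool,
          (∏ s, ((1 - E) * (if w s = y' s then (1 : ℝ) else 0) + E / Fintype.card (Fin n × Bool))) *
            ∏ i : Fin m, (1 - ∏ j : Fin k,
              (if x (y' (i, j)).1 = (y' (i, j)).2 then (0 : ℝ) else 1)) := by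
        refine Finset.sum_congr rfl (fun y' _ => ?_)
        unfold resampleKernel
        rw [hind y']
    _ ≤ (1 - (E / 2) ^ k) ^ m := key

end Summit.PneNP.PneNP.Theorems
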